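import Literature.NumberTheory.PAdicHodge.DualExpElliptic
import Literature.NumberTheory.EllipticCurves.TateModuleBaseChange
import HarnessLib

/-!
# The Néron de Rham line of `V_p(W)|_{Γ_F}` for a curve `W` over a subfield `K ⊆ F`
# (Kato, LNM 1553, Ch. II Ex. 1.3.5, transported along `V_p(W)|_{Γ_F} ≅ V_p(W ×_K F)`)

Topic `Literature/NumberTheory/PAdicHodge`; sequel to `NeronDeRhamDatum.lean` (definition item
`defn-EllipticNeronDeRhamClass`). Definitions with bodies and proved API; no named fact, no `sorry`,
no instance, no notation.

`NeronDeRhamDatum hp W'` is typed for an elliptic curve `W'` OVER the `p`-adic field `F` (a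
generator of the `F`-line `D⁰_dR(V_p W')`). The BSD consumers (cell `bsd-addord`, rung W2: cruxes
`stmt-BirchSwinnertonDyer-19075/19076/19560`) work with a curve `W` over `K = ℚ` and the RESTRICTED
representation `V_p(W)|_{Γ_F}` along `absGaloisRestrict K F : Γ_F → Γ_K` (`F = ℚ_v`, or a finite
extension `L_w`), on which their local cohomology `H¹(F, T_pW)` and the scalar dual exponential
`expStarOmega` (`Theorems/KimAtThreeDeepLowerExpStarOmega`, "local Néron line" `LocalNeronLine W hp r`)
are built; that file records: "`Nonempty (LocalNeronLineAt W p v)` … follows from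
`PAdicHodge.nonempty_neronDeRhamDatum` for `W ×_ℚ ℚ_v` once the restriction isomorphism
`V_p(W)|_{Γ_{ℚ_v}} ≅ V_p(W ×_ℚ ℚ_v)` of Tate modules is in the tree — not in this file". With that
isomorphism now in the tree (`rationalTateModuleEquiv`, file `EllipticCurves/TateModuleBaseChange`,
equivariant along `absGaloisRestrict K F`), this file performs the transport
(`PeriodRingData.FilZeroLine.map`, scale-free) to the restricted representation `restrictedRationalTateRep W F p`
of `DualExpElliptic.lean` (DEFINITIONALLY the cell's `localRationalTateRep` at `K₀ = ℚ`):

* `NeronDeRhamDatum.restrictOfBaseChange hp W d` — a Néron de Rham datum of `W ×_K F` gives a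
  generator of `Fil⁰ D_dR(V_p(W)|_{Γ_F})`; `NeronDeRhamDatum.baseChangeOfRestrict` — conversely;
* `nonempty_filZeroLine_restrict_iff` — the two existence statements are equivalent, hence
  (`nonempty_filZeroLine_restrict_of_nonempty_neronDeRhamDatum`) the construction statement
  `nonempty_neronDeRhamDatum` ("`dim_F D⁰_dR(V_p E) = 1`", Kato Ex. 1.3.5 / Fontaine 1982) yields the
  line datum of the restricted representation, and `finrank_filD_restrict_eq_one` its dimension form.

At `K = ℚ`, `F = ℚ_v` the conclusion is literally `Nonempty (LocalNeronLine W hp (absGaloisRestrict ℚ ℚ_v))`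
of the consumer (its `localRationalTateRep W p r` unfolds to the restricted representation below).

## References

* K. Kato, LNM 1553 (1993), Ch. II Ex. 1.3.5, §2.1.3. [Kato1993LNM1553]
* J.-M. Fontaine, Invent. Math. 65 (1982) 379–409. [Fontaine1982FormesDifferentielles]
* J. H. Silverman, *The Arithmetic of Elliptic Curves*, 2nd ed., III.§7, VII.§4 (`T_ℓ(E)` as a
  module for the decomposition group is the Tate module of `E/K_v`). [SilvermanAEC2009]
-/

noncomputable section

namespace Literature.NumberTheory.PAdicHodge

open Field ValuativeRel
open Literature.NumberTheory.GaloisRepresentations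
open Literature.NumberTheory.GaloisRepresentations.IsNonarchimedeanLocalField
open Literature.NumberTheory.EllipticCurves

section Transport

variable {K : Type} [Field K] [CharZero K] (W : WeierstrassCurve K) [W.IsElliptic]
  {F : Type} [Field F] [Algebra K F] [ValuativeRel F] [TopologicalSpace F]
  [IsNonarchimedeanLocalField F] [CharZero F] {p : ℕ} [Fact p.Prime]
  [Fact (¬ IsUnit (p : integerC F))] [IsAdicComplete (Ideal.span {(p : integerC F)}) (integerC F)]
  (hp : valuation F p < 1) [Algebra ℚ_[p] F]

/-- **Transport of a Néron de Rham datum of `W ×_K F` to the restricted representation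
`V_p(W)|_{Γ_F}`** along the inverse restriction isomorphism `V_p(W ×_K F) ⥲ V_p(W)` (the tree's
`FilZeroLine.map`, with the intertwining `rationalTateModuleEquiv_symm_rationalTateGaloisRep`): a
generator of the `F`-line `Fil⁰ D_dR(V_p(W)|_{Γ_F})`. [cite: Kato1993LNM1553, Ch. II Ex. 1.3.5 and §2.1.3] -/
def NeronDeRhamDatum.restrictOfBaseChange (d : NeronDeRhamDatum hp (W.baseChange F)) :
    (bdRPeriodRingData (F := F) (p := p) hp).FilZeroLine (restrictedRationalTateRep W F p) :=
  d.map (rationalTateModuleEquiv W F p).symm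
    (rationalTateModuleEquiv_symm_rationalTateGaloisRep W F p
      (W.continuous_rationalGaloisRepTate_holds p)
      ((W.baseChange F).continuous_rationalGaloisRepTate_holds p))

/-- The underlying vector: `(id ⊗ V_p(ι_*)⁻¹) d.ω`. [cite: Kato1993LNM1553, Ch. II Ex. 1.3.5] -/
@[simp]
theorem NeronDeRhamDatum.restrictOfBaseChange_ω (d : NeronDeRhamDatum hp (W.baseChange F)) :
    (NeronDeRhamDatum.restrictOfBaseChange W hp d).ω =
      (bdRPeriodRingData (F := F) (p := p) hp).tensorMap
        ((rationalTateModuleEquiv W F p).symm : _ →ₗ[ℚ_[p]] W.rationalTateModule p) d.ω := rfl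

/-- **Conversely**: a generator of `Fil⁰ D_dR(V_p(W)|_{Γ_F})` gives a Néron de Rham datum of
`W ×_K F`, along `V_p(W) ⥲ V_p(W ×_K F)`. [cite: Kato1993LNM1553, Ch. II Ex. 1.3.5 and §2.1.3] -/
def NeronDeRhamDatum.baseChangeOfRestrict
    (d : (bdRPeriodRingData (F := F) (p := p) hp).FilZeroLine (restrictedRationalTateRep W F p)) :
    NeronDeRhamDatum hp (W.baseChange F) :=
  d.map (rationalTateModuleEquiv W F p)
    (rationalTateModuleEquiv_rationalTateGaloisRep_restrict W F p
      (W.continuous_rationalGaloisRepTate_holds p)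
      ((W.baseChange F).continuous_rationalGaloisRepTate_holds p))

/-- **A generator of `Fil⁰ D_dR(V_p(W)|_{Γ_F})` exists iff `W ×_K F` has a Néron de Rham datum.**
[cite: Kato1993LNM1553, Ch. II Ex. 1.3.5] -/
theorem nonempty_filZeroLine_restrict_iff :
    Nonempty ((bdRPeriodRingData (F := F) (p := p) hp).FilZeroLine (restrictedRationalTateRep W F p)) ↔
      Nonempty (NeronDeRhamDatum hp (W.baseChange F)) :=
  ⟨fun ⟨d⟩ => ⟨NeronDeRhamDatum.baseChangeOfRestrict W hp d⟩,
    fun ⟨d⟩ => ⟨NeronDeRhamDatum.restrictOfBaseChange W hp d⟩⟩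

/-- **The construction statement `nonempty_neronDeRhamDatum` ("`dim_F D⁰_dR(V_p E) = 1`" for every
elliptic curve over every `p`-adic field) supplies the Néron line of the RESTRICTED representation
`V_p(W)|_{Γ_F}`** — the datum the BSD consumers' `expStarOmega` is read along
(`Nonempty (LocalNeronLine W hp (absGaloisRestrict ℚ ℚ_v))` at `K = ℚ`).
[cite: Kato1993LNM1553, Ch. II Ex. 1.3.5 and §2.1.3] [cite: Fontaine1982FormesDifferentielles] -/
theorem nonempty_filZeroLine_restrict_of_nonempty_neronDeRhamDatum (h : nonempty_neronDeRhamDatum) :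
    Nonempty ((bdRPeriodRingData (F := F) (p := p) hp).FilZeroLine (restrictedRationalTateRep W F p)) :=
  (nonempty_filZeroLine_restrict_iff W hp).2 (h hp (W.baseChange F))

/-- The chosen line datum of `V_p(W)|_{Γ_F}` from the construction statement (consumers' entry
point, cf. `neronDeRhamDatumOf`). [cite: Kato1993LNM1553, Ch. II Ex. 1.3.5] -/
def filZeroLineRestrictOf (h : nonempty_neronDeRhamDatum) :
    (bdRPeriodRingData (F := F) (p := p) hp).FilZeroLine (restrictedRationalTateRep W F p) :=
  NeronDeRhamDatum.restrictOfBaseChange W hp (neronDeRhamDatumOf hp h (W.baseChange F))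

/-- **Dimension form: `dim_F Fil⁰ D_dR(V_p(W)|_{Γ_F}) = 1`** under the construction statement
(`FilZeroLine.finrank_filD_eq_one`). [cite: Kato1993LNM1553, Ch. II Ex. 1.3.5] -/
theorem finrank_filD_restrict_eq_one (h : nonempty_neronDeRhamDatum) :
    Module.finrank F
        ((bdRPeriodRingData (F := F) (p := p) hp).filD (restrictedRationalTateRep W F p) 0) = 1 :=
  (filZeroLineRestrictOf W hp h).finrank_filD_eq_one

/-- The dimension statements for `W ×_K F` and for `V_p(W)|_{Γ_F}` are equivalent (unconditionally).
[cite: Kato1993LNM1553, Ch. II Ex. 1.3.5] -/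
theorem finrank_filD_restrict_eq_one_iff :
    Module.finrank F
        ((bdRPeriodRingData (F := F) (p := p) hp).filD (restrictedRationalTateRep W F p) 0) = 1 ↔
      Module.finrank F
        ((bdRPeriodRingData (F := F) (p := p) hp).filD (rationalTateRep (W.baseChange F) p) 0) = 1 := by
  rw [← PeriodRingData.FilZeroLine.nonempty_filZeroLine_iff,
    ← PeriodRingData.FilZeroLine.nonempty_filZeroLine_iff]
  exact nonempty_filZeroLine_restrict_iff W hp

end Transport

end Literature.NumberTheory.PAdicHodge

end
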